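import Mathlib
import HarnessLib
import Literature.MathematicalPhysics.QuantumLattice.DWaveSourceFreePressure
import Literature.MathematicalPhysics.QuantumLattice.HubbardLiebBasis
import Literature.MathematicalPhysics.QuantumLattice.SectorSpectrum
import Summits.HubbardSuperconductivity.HubbardSuperconductivity.Theorems.WeakCouplingBCSWcbcsSourcedFreeGasCooperLogBdG

/-!
# Route `WeakCouplingBCS`, support item `WcbcsLegendreCeiling` (stmt-HubbardSuperconductivity-1197):
# one Bogoliubov implementer for all BdG block sums, and doubly-filled free eigenvectors

Helper file (`--supports stmt-HubbardSuperconductivity-1197`), complementing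
`WeakCouplingBCSWcbcsSourcedFreeGasCooperLogBdG.lean` (momentum form `sourcedFreeTorus_eq_sum`, real
partition function and BdG levels of the free torus gas with a pair source of arbitrary form factor).
PROVED here, and not contained there:

* `exists_bdg_conj` — ONE implementer `W, W'` with BOTH `W'W = 1` and `WW' = 1` conjugating, for every
  even `ξ` and every `D`, the on-site block sum `Σ_x [ξ(k_x)(n_{x↑}+n_{x↓}) + D(k_x)(c_{x↓}c_{x↑} + h.c.)]`
  into `Σ_k [ξ_k (n_{k↑}+n_{k↓}) + D_k (b_k + b_k†)]` (`b_k = c_{-k↓}c_{k↑}`);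
* `exists_bdg_conj_sourcedFree` — the same implementer maps the block sum at `ξ = ε_L - μ`, `D = h w_g`
  onto `K_μ - h(Δ_g + Δ_g†)` AND commutes with the particle number, `W N W' = N`;
* `partitionFn_sourcedFree` — the complex-valued closed form of `Tr e^{-β(K_μ - h(Δ_g+Δ_g†))}`;
* `exists_isNParticle_eigenvector_free` — for every finite set `S` of momenta a unit vector with
  exactly `2|S|` particles and `K_μ u = 2Σ_{k∈S} (ε_L(k) - μ) u`: the doubly filled plane-wave Slater
  determinant, obtained as the image under `W` of an occupation-basis vector, on which the on-site form
  of `K_μ` is diagonal (definite particle number by `W N W' = N`).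

Bratteli–Robinson II §5.2.1–5.2.2 (Bogoliubov transformations `Γ(U)`); de Gennes (1966) Ch. 5;
von Delft–Ralph (2001) §4.2. No definitions; everything is proved.
-/

set_option linter.dupNamespace false

namespace Summit.HubbardSuperconductivity.HubbardSuperconductivity.Theorems

namespace WcbcsLegendre

open Literature.MathematicalPhysics.QuantumLattice Literature.Probability.LatticeModels Matrix Finset
open scoped ComplexConjugate

variable {L : ℕ} [NeZero L]

/-! ### One implementer for all on-site BdG block sums -/

/-- **The Bogoliubov implementer of the BdG relabelling conjugates every on-site block sum into its
momentum form**: there are `W, W'` with `W'W = WW' = 1` such that for all real `ξ` EVEN under `k ↦ -k`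
and all real `D`,
`W (Σ_x [ξ(k_x)(n_{x↑}+n_{x↓}) + D(k_x)(c_{x↓}c_{x↑} + h.c.)]) W' = Σ_k [ξ_k (n_{k↑}+n_{k↓}) + D_k (b_k + b_k†)]`
(`k_x` the momentum label with the coordinates of the site `x`; `W c_{x↑} W' = c_{k_x↑}`,
`W c_{x↓} W' = c_{-k_x↓}`). [cite: deGennes1966, Ch. 5 (Bogoliubov transformation of the BdG Hamiltonian)] -/
theorem exists_bdg_conj :
    ∃ W W' : Matrix (Finset (Orb (FermionTorus 2 L))) (Finset (Orb (FermionTorus 2 L))) ℂ,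
      W' * W = 1 ∧ W * W' = 1 ∧
      ∀ (ξ D : TorusSite 2 L → ℝ), (∀ k, ξ (-k) = ξ k) →
        W * (∑ x : FermionTorus 2 L,
          (((ξ x.toTorusSite : ℝ) : ℂ) • (numberOp x 0 + numberOp x 1) +
            ((D x.toTorusSite : ℝ) : ℂ) •
              (annihilation (orb x 1) * annihilation (orb x 0) +
                (annihilation (orb x 1) * annihilation (orb x 0))ᴴ))) * W' =
        ∑ k : TorusSite 2 L, (((ξ k : ℝ) : ℂ) • (momentumNumber k 0 + momentumNumber k 1) +
          ((D k : ℝ) : ℂ) • (pairMode k + (pairMode k)ᴴ)) := by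
  obtain ⟨W, W', h1, h2, ha0, ha1, hc0, hc1⟩ := exists_bdg_implementer (L := L)
  refine ⟨W, W', h1, h2, fun ξ D hξ => ?_⟩
  have hnum : ∀ (x : FermionTorus 2 L), W * (numberOp x 0 + numberOp x 1) * W' =
      momentumNumber x.toTorusSite 0 + momentumNumber (-x.toTorusSite) 1 := by
    intro x
    rw [mul_add, add_mul, numberOp, numberOp, conj_mul_of_mul_eq_one h1, conj_mul_of_mul_eq_one h1,
      hc0, ha0, hc1, ha1, momentumNumber, momentumNumber]
  have hpair : ∀ (x : FermionTorus 2 L),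
      W * (annihilation (orb x 1) * annihilation (orb x 0) + (annihilation (orb x 1) * annihilation (orb x 0))ᴴ) * W' =
      pairMode x.toTorusSite + (pairMode x.toTorusSite)ᴴ := by
    intro x
    rw [pairMode_conjTranspose, pairMode, mul_add, add_mul, conjTranspose_mul, annihilation_conjTranspose,
      annihilation_conjTranspose, conj_mul_of_mul_eq_one h1, conj_mul_of_mul_eq_one h1, ha1, ha0, hc0, hc1]
  have hsum : W * (∑ x : FermionTorus 2 L,
        (((ξ x.toTorusSite : ℝ) : ℂ) • (numberOp x 0 + numberOp x 1) +
          ((D x.toTorusSite : ℝ) : ℂ) •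
            (annihilation (orb x 1) * annihilation (orb x 0) +
              (annihilation (orb x 1) * annihilation (orb x 0))ᴴ))) * W' =
      ∑ x : FermionTorus 2 L,
        (((ξ x.toTorusSite : ℝ) : ℂ) • (momentumNumber x.toTorusSite 0 + momentumNumber (-x.toTorusSite) 1) +
          ((D x.toTorusSite : ℝ) : ℂ) • (pairMode x.toTorusSite + (pairMode x.toTorusSite)ᴴ)) := by
    rw [conj_sum_smul_add_smul]
    exact Finset.sum_congr rfl fun x _ => by rw [hnum, hpair]
  rw [hsum]
  have hreidx : ∑ z : TorusSite 2 L, ((ξ z : ℝ) : ℂ) • momentumNumber (-z) 1 =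
      ∑ z : TorusSite 2 L, ((ξ z : ℝ) : ℂ) • momentumNumber z 1 := by
    rw [← Equiv.sum_comp (Equiv.neg (TorusSite 2 L))]
    refine Finset.sum_congr rfl fun z _ => ?_
    simp only [Equiv.neg_apply, neg_neg, hξ]
  rw [FermionTorus.sum_eq_sum_torusSite]
  simp only [FermionTorus.toTorusSite_ofTorusSite, smul_add, Finset.sum_add_distrib, hreidx]

/-- The on-site block sum at `ξ = ε_L - μ`, `D = h w_g` is conjugate to `K_μ - h(Δ_g + Δ_g†)` (`L ≥ 3`),
and the same implementer commutes with the particle number: `W N W' = N`. [folklore] -/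
theorem exists_bdg_conj_sourcedFree (hL : 3 ≤ L) (g : Site 2 → ℝ) (μ h : ℝ) :
    ∃ W W' : Matrix (Finset (Orb (FermionTorus 2 L))) (Finset (Orb (FermionTorus 2 L))) ℂ,
      W' * W = 1 ∧ W * W' = 1 ∧
      W * (∑ x : FermionTorus 2 L,
          (((torusBand L x.toTorusSite - μ : ℝ) : ℂ) • (numberOp x 0 + numberOp x 1) +
            ((h * pairFieldMode g L x.toTorusSite : ℝ) : ℂ) •
              (annihilation (orb x 1) * annihilation (orb x 0) +
                (annihilation (orb x 1) * annihilation (orb x 0))ᴴ))) * W' =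
        hubbardTorusWith 2 L 1 0 μ - (h : ℂ) • (pairField g L + (pairField g L)ᴴ) ∧
      W * totalNumber * W' = totalNumber := by
  obtain ⟨W, W', h1, h2, hconj⟩ := exists_bdg_conj (L := L)
  refine ⟨W, W', h1, h2, ?_, ?_⟩
  · rw [sourcedFreeTorus_eq_sum hL g μ h]
    exact hconj (fun k => torusBand L k - μ) (fun k => h * pairFieldMode g L k) fun k => by rw [torusBand_neg]
  · have hc := hconj (fun _ => 1) (fun _ => 0) fun _ => rfl
    simp only [Complex.ofReal_one, one_smul, Complex.ofReal_zero, zero_smul, add_zero] at hc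
    have hN : (totalNumber : Matrix (Finset (Orb (FermionTorus 2 L))) _ ℂ) =
        ∑ x : FermionTorus 2 L, (numberOp x 0 + numberOp x 1) := by
      unfold totalNumber
      refine Finset.sum_congr rfl fun x _ => ?_
      rw [Fin.sum_univ_two]
    have hN' : (totalNumber : Matrix (Finset (Orb (FermionTorus 2 L))) _ ℂ) =
        ∑ k : TorusSite 2 L, (momentumNumber k 0 + momentumNumber k 1) := by
      rw [totalNumber_eq_sum_momentumNumber]
      refine Finset.sum_congr rfl fun k _ => ?_
      rw [Fin.sum_univ_two]
    rw [hN, hc, ← hN']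
    exact hN

/-! ### The partition function -/

/-- **BdG partition function of the free torus with a pair source of form factor `g`** (`L ≥ 3`):
`Tr e^{-β(K_μ - h(Δ_g+Δ_g†))} = 2^{|Orb|} Π_k e^{-βξ_k}(1 + cosh(β√(ξ_k² + h² w_g(k)²)))/2`.
[cite: VondelftRalph2001, §4.2] -/
theorem partitionFn_sourcedFree (hL : 3 ≤ L) (g : Site 2 → ℝ) (β μ h : ℝ) :
    partitionFn β (hubbardTorusWith 2 L 1 0 μ - (h : ℂ) • (pairField g L + (pairField g L)ᴴ)) =
      (2 : ℂ) ^ Fintype.card (Orb (FermionTorus 2 L)) *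
        ∏ k : TorusSite 2 L, ((Real.exp (-(β * (torusBand L k - μ))) *
          ((1 + Real.cosh (β * Real.sqrt ((torusBand L k - μ) ^ 2 +
            (h * pairFieldMode g L k) ^ 2))) / 2) : ℝ) : ℂ) := by
  obtain ⟨W, W', h1, -, hconj, -⟩ := exists_bdg_conj_sourcedFree hL g μ h
  rw [← hconj, partitionFn_conj_of_mul_eq_one h1]
  have key := trace_exp_neg_smul_sum_onSiteBdG (Λ := FermionTorus 2 L)
    (fun x => torusBand L x.toTorusSite - μ) (fun x => h * pairFieldMode g L x.toTorusSite) β Finset.univ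
  have hprod : ∀ f : TorusSite 2 L → ℂ,
      ∏ x : FermionTorus 2 L, f x.toTorusSite = ∏ k : TorusSite 2 L, f k := fun f =>
    Fintype.prod_equiv FermionTorus.equivTorusSite _ _ fun _ => rfl
  rw [hprod (fun k => ((Real.exp (-(β * (torusBand L k - μ))) *
          ((1 + Real.cosh (β * Real.sqrt ((torusBand L k - μ) ^ 2 +
            (h * pairFieldMode g L k) ^ 2))) / 2) : ℝ) : ℂ))] at key
  rw [partitionFn, gibbsWeight]
  convert key using 4

/-! ### Free `N`-particle eigenvectors: doubly filled momentum sets -/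

/-- **Filling a set of momenta with both spins gives a free eigenvector** (`L ≥ 3`): for every finite
set `S` of momentum labels there is a unit vector `u` with exactly `2|S|` particles and
`K_μ u = 2 Σ_{k ∈ S} (ε_L(k) - μ) u`, `K_μ = hubbardTorusWith 2 L 1 0 μ` — the image under the BdG
implementer `W` of the occupation-basis vector of the orbitals `{(x, σ) : k_x ∈ S}`, on which the
conjugate on-site form `Σ_x ξ(k_x)(n_{x↑} + n_{x↓})` of `K_μ` is diagonal (the Slater determinant
`Π_{k ∈ S} c†_{k↑} c†_{-k↓} |0⟩`). [cite: BratteliRobinsonII1997, §5.2.1] -/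
theorem exists_isNParticle_eigenvector_free (hL : 3 ≤ L) (μ : ℝ) (S : Finset (TorusSite 2 L)) :
    ∃ u : Fock (Orb (FermionTorus 2 L)), star u ⬝ᵥ u = 1 ∧ IsNParticle (2 * S.card) u ∧
      hubbardTorusWith 2 L 1 0 μ *ᵥ u = ((2 * ∑ k ∈ S, (torusBand L k - μ) : ℝ) : ℂ) • u := by
  obtain ⟨W, W', h1, -, hconj, hN⟩ := exists_bdg_conj_sourcedFree hL (fun _ => 0) μ 0
  simp only [Complex.ofReal_zero, zero_smul, sub_zero, zero_mul, add_zero] at hconj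
  set Y := ∑ x : FermionTorus 2 L, ((torusBand L x.toTorusSite - μ : ℝ) : ℂ) •
    (numberOp x 0 + numberOp x 1) with hY
  -- the occupied orbitals `{(x, σ) : k_x ∈ S}`
  set emb : TorusSite 2 L × Fin 2 → Orb (FermionTorus 2 L) :=
    fun p => orb (FermionTorus.ofTorusSite p.1) p.2 with hemb
  have hinj : Function.Injective emb := by
    intro p q hpq
    obtain ⟨h1', h2'⟩ := orb_eq_orb_iff.1 hpq
    have : p.1 = q.1 := by
      rw [← FermionTorus.toTorusSite_ofTorusSite p.1, h1', FermionTorus.toTorusSite_ofTorusSite]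
    exact Prod.ext this h2'
  set s₀ : Finset (Orb (FermionTorus 2 L)) := (S ×ˢ (Finset.univ : Finset (Fin 2))).map ⟨emb, hinj⟩
    with hs₀
  have hmem : ∀ (x : FermionTorus 2 L) (σ : Fin 2), orb x σ ∈ s₀ ↔ x.toTorusSite ∈ S := by
    intro x σ
    rw [hs₀, Finset.mem_map]
    constructor
    · rintro ⟨p, hp, hpx⟩
      obtain ⟨h1', -⟩ := orb_eq_orb_iff.1 hpx
      rw [← h1', FermionTorus.toTorusSite_ofTorusSite]
      exact (Finset.mem_product.1 hp).1
    · intro hx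
      exact ⟨(x.toTorusSite, σ), Finset.mem_product.2 ⟨hx, Finset.mem_univ _⟩, by
        simp [hemb, FermionTorus.ofTorusSite_toTorusSite]⟩
  have hcard : s₀.card = 2 * S.card := by
    rw [hs₀, Finset.card_map, Finset.card_product, Finset.card_univ, Fintype.card_fin, mul_comm]
  set e : Fock (Orb (FermionTorus 2 L)) := Pi.single s₀ 1 with he
  -- the on-site form is diagonal on `e`
  have hsum : ∑ x : FermionTorus 2 L, ((torusBand L x.toTorusSite - μ : ℝ) : ℂ) *
      (if x.toTorusSite ∈ S then (1 : ℂ) else 0) = ∑ k ∈ S, ((torusBand L k - μ : ℝ) : ℂ) := by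
    rw [FermionTorus.sum_eq_sum_torusSite]
    simp only [FermionTorus.toTorusSite_ofTorusSite, mul_ite, mul_one, mul_zero]
    rw [← Finset.sum_filter, Finset.filter_mem_eq_inter, Finset.univ_inter]
  have hYe : Y *ᵥ e = ((2 * ∑ k ∈ S, (torusBand L k - μ) : ℝ) : ℂ) • e := by
    funext t
    rw [hY, Matrix.sum_mulVec, Finset.sum_apply, Pi.smul_apply, smul_eq_mul]
    by_cases ht : t = s₀
    · have het : e t = 1 := by rw [ht, he, Pi.single_eq_same]
      have hterm : ∀ x : FermionTorus 2 L,
          ((((torusBand L x.toTorusSite - μ : ℝ) : ℂ) • (numberOp x 0 + numberOp x 1)) *ᵥ e) t =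
            ((torusBand L x.toTorusSite - μ : ℝ) : ℂ) * (if x.toTorusSite ∈ S then (1 : ℂ) else 0) * 2 := by
        intro x
        rw [Matrix.smul_mulVec, Pi.smul_apply, Matrix.add_mulVec, Pi.add_apply,
          LiebTwo.numberOp_mulVec, LiebTwo.numberOp_mulVec, het, smul_eq_mul, ht]
        by_cases hx : x.toTorusSite ∈ S
        · rw [if_pos ((hmem x 0).2 hx), if_pos ((hmem x 1).2 hx), if_pos hx]; ring
        · rw [if_neg (fun h => hx ((hmem x 0).1 h)), if_neg (fun h => hx ((hmem x 1).1 h)), if_neg hx]; ring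
      simp_rw [hterm]
      rw [← Finset.sum_mul, hsum, het, mul_one]
      push_cast
      ring
    · have het : e t = 0 := by rw [he, Pi.single_eq_of_ne ht]
      have hterm : ∀ x : FermionTorus 2 L,
          ((((torusBand L x.toTorusSite - μ : ℝ) : ℂ) • (numberOp x 0 + numberOp x 1)) *ᵥ e) t = 0 := by
        intro x
        rw [Matrix.smul_mulVec, Pi.smul_apply, Matrix.add_mulVec, Pi.add_apply,
          LiebTwo.numberOp_mulVec, LiebTwo.numberOp_mulVec, het, smul_eq_mul]
        simp
      simp_rw [hterm]
      rw [Finset.sum_const_zero, het, mul_zero]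
  have hNe : (totalNumber : Matrix _ _ ℂ) *ᵥ e = ((s₀.card : ℕ) : ℂ) • e := by
    funext t
    rw [LiebTwo.totalNumber_mulVec, Pi.smul_apply, smul_eq_mul]
    by_cases ht : t = s₀
    · rw [ht]
    · rw [he, Pi.single_eq_of_ne ht, mul_zero, mul_zero]
  -- the eigenvector `v = W e`
  set v := W *ᵥ e with hv
  have hKv : hubbardTorusWith 2 L 1 0 μ *ᵥ v = ((2 * ∑ k ∈ S, (torusBand L k - μ) : ℝ) : ℂ) • v := by
    rw [← hconj, hv, mulVec_mulVec, Matrix.mul_assoc, h1, Matrix.mul_one, ← mulVec_mulVec, hYe, mulVec_smul]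
  have hNv : (totalNumber : Matrix _ _ ℂ) *ᵥ v = ((s₀.card : ℕ) : ℂ) • v := by
    rw [hv]
    conv_lhs => rw [← hN]
    rw [mulVec_mulVec, Matrix.mul_assoc, h1, Matrix.mul_one, ← mulVec_mulVec, hNe, mulVec_smul]
  have hv0 : v ≠ 0 := by
    intro h0
    have : e = 0 := by
      calc e = (W' * W) *ᵥ e := by rw [h1, one_mulVec]
        _ = W' *ᵥ v := by rw [← mulVec_mulVec, hv]
        _ = 0 := by rw [h0, mulVec_zero]
    have h3 := congrFun this s₀
    rw [he, Pi.single_eq_same, Pi.zero_apply] at h3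
    exact one_ne_zero h3
  obtain ⟨c, -, hc1⟩ := exists_smul_unit hv0
  refine ⟨c • v, hc1, ?_, ?_⟩
  · intro t ht
    have h3 := congrFun hNv t
    rw [LiebTwo.totalNumber_mulVec, Pi.smul_apply, smul_eq_mul, hcard] at h3
    have h4 : ((t.card : ℂ) - ((2 * S.card : ℕ) : ℂ)) * v t = 0 := by rw [sub_mul, h3, sub_self]
    have h5 : (t.card : ℂ) - ((2 * S.card : ℕ) : ℂ) ≠ 0 := by
      rw [sub_ne_zero]
      exact_mod_cast ht
    rw [Pi.smul_apply, (mul_eq_zero.1 h4).resolve_left h5, smul_zero]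
  · rw [mulVec_smul, hKv, smul_comm]

end WcbcsLegendre

end Summit.HubbardSuperconductivity.HubbardSuperconductivity.Theorems
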